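import Summits.RiemannHypothesis.RiemannHypothesis.Theorems.HandoffDodgerCriterion
import HarnessLib

/-!
# HANDOFF — the EXPONENT-3/2 WALL-CEILING TARGET and its reduction to a sub-window witness family (rh-explicit, track «HANDOFF», seat prove-2 gen7, ATTEMPT-15 §5 — statements + the one-line reduction)

HONEST FRAMING. Nothing here bears on the truth of RH. This file TYPES the target of RH-PROMISE § 0′ T1.4 (L5) in the form
ATTEMPT-15 argues for — an RH-free UPPER bound on the wall offset `δ*(q) = a*(S_{<q}) − (log q)/2` of shape
`C·(log q)^{3/2}·q^{−3/2}` (`DodgerWallCeiling C q₀`; the data law (WL) reads `≈ 0.053·q^{−3/2}/log q`, the tree's RH-free bound is the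
Cramér-scale `HandoffWallCeiling.wallOffset_lt_ceiling`) — and the analytic INPUT it is reduced to by the small-translate criterion
`wallOffset_lt_of_translatePair` (HandoffDodgerCriterion): a `SubwindowWitnessFamily` = for every large prime `q` a Weil test function
on the `q`-subwindow whose `δ`-pair has full-form (zero-side) energy below its weighted collar overlap at a shift
`δ ≤ C·(log q)^{3/2}·q^{−3/2}` inside the handoff window. `dodgerWallCeiling_of_subwindowWitnessFamily` is that reduction (a theorem);
the family itself is NOT constructed here: ATTEMPT-15 §2–§5 (HOME/handoff/prove-2/) gives it at paper level (zero-dodgers; DERIVED-MODEL +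
DERIVED-FLOAT at q = 13, 29 and a kit sweep to q = 503) and lists the four standard estimates (E1)–(E4) a proof needs. No `sorry`, no axiom,
no claim beyond the reduction.

References (as printed): E. Bombieri, Rend. Mat. Acc. Lincei (9) 11 (2000) Thm 2, §4 [`Bombieri2000Weil`]; A. Connes, Selecta Math. 5 (1999)
§VII Thm 4 [`Connes1999`].
-/

set_option linter.dupNamespace false

noncomputable section

open Complex Filter Set MeasureTheory Literature.NumberTheory.LFunctions
open Summit.RiemannHypothesis.RiemannHypothesis.Theorems.MotivicDoor.SemilocalThreshold
open Summit.RiemannHypothesis.RiemannHypothesis.Theorems.HandoffMarginLaw (wallOffset)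
open Summit.RiemannHypothesis.RiemannHypothesis.Theorems.HandoffDecomposition (nextPrime consecutivePrimes_nextPrime)
open scoped Real Topology

namespace Summit.RiemannHypothesis.RiemannHypothesis.Theorems.Handoff

/-- **TARGET (typed, NOT proved): the exponent-3/2 RH-free wall ceiling** with constant `C` from `q₀` on:
`∀ primes q ≥ q₀, δ*(q) ≤ C·(log q)^{3/2}·q^{−3/2}`. ATTEMPT-15's zero-dodger analysis supports it at DERIVED-MODEL level
(`δ_A(q) ≈ 0.075·y(q)·q^{−3/2}`, `y = O((log q)^{3/2})`); the tree proves only the Cramér-scale ceiling. [this track, ATTEMPT-15 §5; RH-PROMISE § 0′ T1.4 (L5)] -/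
def DodgerWallCeiling (C : ℝ) (q₀ : ℕ) : Prop :=
  ∀ q : ℕ, q.Prime → q₀ ≤ q → wallOffset q ≤ C * Real.log q ^ (3 / 2 : ℝ) * (q : ℝ) ^ (-(3 / 2 : ℝ))

/-- **The analytic input (typed, NOT proved): a SUB-WINDOW WITNESS FAMILY** at scale `C·(log q)^{3/2}·q^{−3/2}` — for all consecutive
primes `q < q′` with `q ≥ q₀`, a Weil test function `θ` supported in `[−(log q)/2, (log q)/2]` and a shift `0 ≤ δ ≤ C(log q)^{3/2}q^{−3/2}`
inside the window (`(log q)/2 + δ ≤ (log q′)/2`) with `Re Q(θ(·−δ) − θ(·+δ)) < (2 log q/√q)·Re k_θ(log q − 2δ)`.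
ATTEMPT-15 §2–§5: the zero-dodgers are such `θ` at paper level; estimates (E1)–(E4) there. [this track, ATTEMPT-15 §3, §5] -/
def SubwindowWitnessFamily (C : ℝ) (q₀ : ℕ) : Prop :=
  ∀ q q' : ℕ, ConsecutivePrimes q q' → q₀ ≤ q →
    ∃ θ : ℝ → ℂ, ∃ δ : ℝ, IsWeilTest θ ∧ tsupport θ ⊆ Icc (-(Real.log q / 2)) (Real.log q / 2) ∧ 0 ≤ δ ∧
      δ ≤ C * Real.log q ^ (3 / 2 : ℝ) * (q : ℝ) ^ (-(3 / 2 : ℝ)) ∧ Real.log q / 2 + δ ≤ Real.log q' / 2 ∧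
      (weilQuadratic fun x ↦ θ (x - δ) - θ (x + δ)).re <
        2 * Real.log q / Real.sqrt q * (weilConv θ (weilReflect θ) (Real.log q - 2 * δ)).re

/-- **The reduction (THEOREM): a sub-window witness family gives the exponent-3/2 ceiling**, by the small-translate criterion
`wallOffset_lt_of_translatePair` applied at each prime with its successor `nextPrime q`. RH-free; upper bounds on walls only.
[this track, ATTEMPT-15 §5] -/
theorem dodgerWallCeiling_of_subwindowWitnessFamily {C : ℝ} {q₀ : ℕ} (h : SubwindowWitnessFamily C q₀) :
    DodgerWallCeiling C q₀ := by
  intro q hq hq₀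
  obtain ⟨θ, δ, hθ, hθs, hδ, hδC, hwin, hneg⟩ := h q (nextPrime q) (consecutivePrimes_nextPrime hq) hq₀
  exact (wallOffset_lt_of_translatePair (consecutivePrimes_nextPrime hq) hθ hθs hδ hwin hneg).le.trans hδC

/-- Pointwise form used by ATTEMPT-15's tables: ONE smooth witness `θ` (`IsWeilTest`) at ONE prime bounds that prime's wall offset — the
consumer for the MOLLIFIED variant-A pair. ERRATUM (referee r30/r31 P15-c; ATTEMPT-15 v1.7 §4.C): the vectors CERTIFIED by cc-s2-6 (CHECK ASK #4) are
truncated odd sine series with a JUMP at `±b₁`, hence NOT `IsWeilTest`; their tree bridge is the jump-tolerant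
`MotivicDoor.SemilocalMarkov.weilSemilocalThreshold_le_of_markovWitness_window` (`IsMarkovWitness`: bounded, measurable, odd, a.e.-continuous,
vanishing off the window), not this lemma — and that bridge is not instantiated in Lean for any cell. [this track, ATTEMPT-15 §4, §7] -/
theorem wallOffset_le_of_witness {q q' : ℕ} {θ : ℝ → ℂ} {δ B : ℝ} (h : ConsecutivePrimes q q') (hθ : IsWeilTest θ)
    (hθs : tsupport θ ⊆ Icc (-(Real.log q / 2)) (Real.log q / 2)) (hδ : 0 ≤ δ) (hδB : δ ≤ B)
    (hwin : Real.log q / 2 + δ ≤ Real.log q' / 2)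
    (hneg : (weilQuadratic fun x ↦ θ (x - δ) - θ (x + δ)).re <
      2 * Real.log q / Real.sqrt q * (weilConv θ (weilReflect θ) (Real.log q - 2 * δ)).re) :
    wallOffset q ≤ B :=
  (wallOffset_lt_of_translatePair h hθ hθs hδ hwin hneg).le.trans hδB

end Summit.RiemannHypothesis.RiemannHypothesis.Theorems.Handoff
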